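import Mathlib
import HarnessLib
import Literature.MathematicalPhysics.StatisticalMechanics.LennardJonesClusters

/-!
# Crux `GroundStateVarianceCertificate` (stmt-AtomisticToContinuum-11859), line `registered`:
# the certificate is free for `N ≤ C + 1` (Cauchy–Schwarz per site)

Helper file of the lead (c2). For ANY configuration `x : Fin N → ℝᵈ` (no ground-state input, no
geometry) and every site `i`, Cauchy–Schwarz over the `N - 1` other particles gives

  `s_i² = (Σ_{k ≠ i} r_ik⁻⁶)² ≤ (N - 1) · Σ_{k ≠ i} r_ik⁻¹² = (N - 1) · t_i`,

hence `Σ_i s_i² ≤ (N - 1) · Σ_i t_i`: the variance-form certificate `Σ s² ≤ C Σ t` holds trivially for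
`N ≤ C + 1` particles. With the tree's certified periodic energy `e(fcc, a = 1) ≤ -1/2`
(`-24 e ≥ 12`) this settles the by-particle-number split of the skeleton up to `N ≤ 13`
(`certificate_of_le_thirteen`), superseding the geometric `N ≤ 4` stub; with the sharp constant
`Φ⋆ ≈ 17.22` the free range would be `N ≤ 18`. The open core of the line is therefore `N ≥ 14`
(resp. `N ≥ 19`): the certificate is a statement about MANY-particle ground states only.
All `[folklore]`.
-/

noncomputable section

open scoped BigOperators
open Literature.MathematicalPhysics.StatisticalMechanics

namespace Summit.AtomisticToContinuum.Crystallization.Theorems.GroundStateVarianceCertificateLine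

variable {d N : ℕ}

/-- **Cauchy–Schwarz per site.** `s_i² ≤ (N - 1) · t_i` for every configuration and every site:
`(Σ_{k≠i} u_k)² ≤ #{k ≠ i} · Σ_{k≠i} u_k²` with `u_k = r_ik⁻⁶`, `u_k² = r_ik⁻¹²`. [folklore] -/
theorem sq_siteEnergy_inv_pow_six_le (x : Fin N → EuclideanSpace ℝ (Fin d)) (i : Fin N) :
    (siteEnergy (fun r => (r⁻¹) ^ 6) x i) ^ 2 ≤
      ((N : ℝ) - 1) * siteEnergy (fun r => (r⁻¹) ^ 12) x i := by
  unfold siteEnergy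
  have hcs := sq_sum_le_card_mul_sum_sq (s := Finset.univ.erase i)
    (f := fun k => ((dist (x i) (x k))⁻¹) ^ 6)
  have hcard : ((Finset.univ.erase i).card : ℝ) = (N : ℝ) - 1 := by
    rw [Finset.card_erase_of_mem (Finset.mem_univ i), Finset.card_univ, Fintype.card_fin,
      Nat.cast_sub (Nat.succ_le_of_lt (Fin.pos i)), Nat.cast_one]
  have h12 : ∀ k : Fin N, (((dist (x i) (x k))⁻¹) ^ 6) ^ 2 = ((dist (x i) (x k))⁻¹) ^ 12 :=
    fun k => by ring
  simp only [h12] at hcs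
  rw [hcard] at hcs
  exact hcs

/-- **The certificate is free for few particles.** For every configuration of `N` points of `ℝᵈ`,
`Σ_i s_i² ≤ (N - 1) · Σ_i t_i`. [folklore] -/
theorem sum_sq_siteEnergy_le_card_mul (x : Fin N → EuclideanSpace ℝ (Fin d)) :
    ∑ i, (siteEnergy (fun r => (r⁻¹) ^ 6) x i) ^ 2 ≤
      ((N : ℝ) - 1) * ∑ i, siteEnergy (fun r => (r⁻¹) ^ 12) x i := by
  rw [Finset.mul_sum]
  exact Finset.sum_le_sum fun i _ => sq_siteEnergy_inv_pow_six_le x i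

/-- **Clusters of at most thirteen particles** satisfy the certificate with the constant `12`
(`= -24 · (-1/2)`, the certified energy of fcc at nearest-neighbour distance `1`):
`Σ_i s_i² ≤ 12 · Σ_i t_i` — for every configuration, ground state or not. [folklore] -/
theorem certificate_of_le_thirteen :
    ∀ (N : ℕ) (x : Fin N → EuclideanSpace ℝ (Fin 3)), N ≤ 13 →
      ∑ i, (siteEnergy (fun r => (r⁻¹) ^ 6) x i) ^ 2 ≤
        12 * ∑ i, siteEnergy (fun r => (r⁻¹) ^ 12) x i := by
  intro N x hN
  refine (sum_sq_siteEnergy_le_card_mul x).trans ?_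
  have ht : 0 ≤ ∑ i, siteEnergy (fun r => (r⁻¹) ^ 12) x i := by
    refine Finset.sum_nonneg fun i _ => ?_
    unfold siteEnergy
    exact Finset.sum_nonneg fun k _ => by positivity
  have hN' : (N : ℝ) - 1 ≤ 12 := by
    have : (N : ℝ) ≤ 13 := by exact_mod_cast hN
    linarith
  exact mul_le_mul_of_nonneg_right hN' ht

end Summit.AtomisticToContinuum.Crystallization.Theorems.GroundStateVarianceCertificateLine

end
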